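import Summits.BirchSwinnertonDyer.BirchSwinnertonDyer.Theorems.ByReductionTypeAtTwoSupersingularPinch
import Literature.NumberTheory.EllipticCurves.Kato2004.IwasawaCohomology
import Literature.NumberTheory.EllipticCurves.KatoDivisibilityIntegralSkeletonProofs
import Literature.NumberTheory.EllipticCurves.KatoFineSelmerDualProofs
import Literature.NumberTheory.EllipticCurves.TateModuleContinuityProofs
import Literature.NumberTheory.EllipticCurves.Kobayashi2003.SignedSelmerModuleFiniteProofs
import HarnessLib

/-!
# Route `ByReductionTypeAtTwo` (rung K4), crux `SupersingularRankZeroAtTwo` (item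
# stmt-BirchSwinnertonDyer-19097), line `signed_halves_two` v3: THE COLEMAN ROAD — stub (4)
# `stub_zeroSignedUpper` (the Kato-side signed divisibility at `2`) FROM Kato's Thm. 12.4 and ONE
# Coleman / Poitou–Tate / Euler-system package READ AT `2` on PINNED objects (seat `bsd-2adic-ss-1`, GEN 7)

HONEST FRAMING (cell `bsd-2adic`, run/shared/lean/pub/bsd-2adic/, HUMAN RULINGS D-0036/D-0059/D-0074):
THEOREMS ONLY; every research input an explicit hypothesis; no definition, no named fact, no instance,
nothing booked; BSD is not proved by any of this. PARTITION (D-0054): X5@2 good-supersingular, `a₂ = 0`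
sub-row (B1·O1; 208 rank-`0` classes) × `p = 2` — types-the-object-of; closes none. Companion of
`…SupersingularHalvesTwo.lean` (p420436: the Kato half `MissingUpperBoundAt W 2` from the signed
divisibility `hup`) and `…SupersingularPinch.lean` (p450683: the certificate-fed door
`bsdp_two_of_upper_of_pow_dvd`). The registered skeleton v3 is NOT reshaped here.

## What this file proves (the `p = 2`, sign `+`, `η = 1` transcript of Kobayashi's §7)

Kobayashi (Invent. Math. 152 (2003)) proves his Thm. 4.1 (`Char X^± ⊇ (L_p^±)`, the line's stub (4)
read at `2`) on p. 13 from FOUR separately printed statements: Thm. 6.2 (6.13) (the even Coleman map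
`Col⁺ : H¹_Iw(T)/H¹_{Iw,+}(T) ≅ Λ`), Thm. 6.3 (`Col⁺(z) = L_p⁺(E,X)`, `z` Kato's zeta element),
Thm. 7.3 i) (7.21) (`0 → 𝐇¹(T) → H¹_Iw(T)/H¹_{Iw,±}(T) → X^±(E/K_∞) → X⁰(E/K_∞) → 0`, Poitou–Tate)
with Cor. 7.2 (`X⁰` is `Λ`-torsion), and Kato's Thm. 12.5 (4) = his Thm. 5.2 v) (the Euler-system
bound `Char 𝐇²(T) ⊇ Char 𝐇¹(T)/Z(T)` under surjectivity of `ρ_{E,p^∞}`, with Prop. 7.1 ii)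
`𝐇²(T) ≅ X⁰(E/K_∞)`), composed by the module theory of Kato's §17.13 — "The proofs are basically the
same as the good ordinary case (cf. Kato [7])" (p. 11). The tree HOLDS that module theory, PROVED over
an arbitrary domain (`Kato2004.thm17_4_skeleton`, `Kato2004.mem_charIdeal_of_skeleton_integral`,
files `KatoDivisibility{,Integral}SkeletonProofs`, lanes bsd-smallim / b2b-bsdres), and PINS the three
modules the statements are about at EVERY prime, `p = 2` included: `𝐇¹_Γ(T₂W)` =
`Kato2004.IwasawaH1Data W 2 κ γ` (torsion free of rank `1` by the ACCEPTED named fact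
`Kato2004.thm12_4`, Thm. 12.4 (2), typed for every `p`), `X⁰(E/ℚ_∞)` =
`WeierstrassCurve.FineSelmerDualData W κ γ` (inhabited: tree THEOREM `nonempty_fineSelmerDualData`),
`X⁺(E/ℚ_∞)` = `Kobayashi2003.SignedSelmerDualData W κ γ 1` (finitely generated: tree THEOREM
`SignedSelmerDualData.moduleFinite`, any `p`). Hence:

* §1 (any `p`, any sign `ε`, abstract `P = H¹_Iw(T)/H¹_{Iw,ε}`): `signedSelmerDual_isTorsion_of_colemanSkeleton`
  (Kobayashi Thm. 7.3 ii / the torsion clause of Thm. 1.2 FROM the package) and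
  `exists_charGenerator_mul_eq_of_colemanSkeleton` (`char X^ε = (g)`, `g·h = G` for the pinned
  `G = Col(loc z)`: Thm. 4.1 with `n = 0` FROM the package), `dvd_of_dvd_C_pow_mul_of_not_dvd`
  (where the image hypothesis bites: only through the `μ`-part).
* §2 (`p = 2`, `ε = 1`): `signedUpperDivisibility_two_of_colemanKato` — the binder `hup` of
  p420436 / p450683 (= stub (4) AT THE CURVE) from `Kato2004.thm12_4` + the package at the curve;
  `signedUpperDivisibility_two_of_colemanKatoRat_of_mu` — the same from the RATIONAL package (Euler-system
  bound only at the height-one primes `𝔭 ∌ 2`, Kato Thm. 12.5 (3) / Kobayashi Thm. 4.1 first display, NO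
  image hypothesis) plus `μ(X⁺) = 0`.
* Companion file `…SupersingularColemanRoadLine.lean`: the REGISTERED SIGNATURE of `stub_zeroSignedUpper`
  verbatim from `Kato2004.thm12_4` + the ∀-closed package; the class-level door (p450683's
  `bsdp_two_of_upper_of_pow_dvd` with `hup` discharged); the crux BY NAME with stub (4) so replaced.

## The package, field by field (what a D-audit reads; `[cite]` = the odd-`p` print; `@2` = READ AT 2)

For `W` (good supersingular at `2`, `a₂ = 0`), cyclotomic data `(κ, γ)` matching the cyclotomic
variable, the newform `f`, the period ratio `ϖ` (`ϖ·Ω_W = Ω⁺_f`), a Pollack pair `(L⁺, L⁻)` at `2`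
(EXISTS: `exists_isPollackPair_two`; `kobayashiL 1 L⁺ L⁻ = L⁻ = L♭`), a dual datum `D` of
`Sel⁺(E/ℚ_∞)`, there are `I : IwasawaH1Data W 2 κ γ`, `Y : FineSelmerDualData`, a `Λ`-submodule
`P ≤ Λ` (the image of `Col⁺`; `= Λ` by (6.13) in print), `loc : 𝐇¹ → P` (`Col⁺ ∘ loc_𝔭`),
`toX : P → X⁺`, `δ : X⁺ → X⁰`, `Z ≤ 𝐇¹` (Kato's zeta submodule), `G ∈ loc(Z)` with:
(7.21)@2 `Function.Exact loc toX ∧ Function.Exact toX δ` [Kobayashi Thm. 7.3 i)]; Cor. 7.2@2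
`IsTorsion Y.X`; Thm. 6.3@2 with the Néron normalisation `ι G = ϖ · ι L♭` [Kobayashi Thm. 6.3,
Thm. 5.2 iv) (`z ∈ 𝐇¹(T)`: `E[2]` is irreducible at a good supersingular `2`)]; and the Euler-system
bound@2 `length_𝔭 X⁰ ≤ length_𝔭 (𝐇¹/Z)` at EVERY height-one `𝔭` [Kato Thm. 12.5 (4) "Assume `p ≠ 2`"
under (12.5.2) ⊂ `TwoAdicSurjective W`, composed with Prop. 7.1 ii)@2; at `𝔭 = (2)` this field also
carries the real-place comparison of Kato's (14.9.3) "exact up to `×2` in the case `p = 2`", the o1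
ledger `sℝ` of `X5/TwoAdicKatoHTwo.lean`]. The only input printed with an explicit "`p ≠ 2`" is the
Euler-system bound at `𝔭 = (2)`; §2's rational form isolates it: WITHOUT it one gets Kobayashi's
Thm. 4.1 first display at `2` (`2ⁿ·ϖ·L♭ ∈ ι(char X⁺)`), and the image hypothesis is needed exactly for
the `μ`-part (`dvd_of_dvd_C_pow_mul_of_not_dvd`). Printed support at `2`: Kurihara–Otsuki, PAMQ 2
(2006) p. 557 («when `a₂ = 0` … ± Selmer groups as in Kobayashi … same method as for `p > 2`») and
p. 564 («the proofs of [Kato] Theorem 12.4 (3) and Theorem 12.5 (4) can be applied to our case even for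
`p = 2`»); Sprung, JNT 132 (2012) §§2–6 (the Coleman maps at `p = 2`).

References: [Kobayashi2003] Thm. 1.2, 4.1, 5.1, 5.2, 6.2, 6.3, Prop. 7.1, Cor. 7.2, Thm. 7.3 (pp. 2,
8–13); [Kato2004Asterisque] Thm. 12.4, 12.5, §17.13; [KuriharaOtsuki2006] pp. 557, 564; [Sprung2012]
§§2–6; [BDKim2013] Cor. 3.15; [Miller2011LMS] Def. 1.1.
-/

set_option autoImplicit false
-- the Theorems namespace of this sub repeats the summit name by design (D-0017 nested layout)
set_option linter.dupNamespace false

noncomputable section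

open scoped Classical MatrixGroups ModularForm

open CongruenceSubgroup WeierstrassCurve Literature.NumberTheory.EllipticCurves
  Literature.NumberTheory.EllipticCurves.ModularForms Literature.NumberTheory.EllipticCurves.Sprung2017
  Literature.NumberTheory.EllipticCurves.Rank1Residual Literature.NumberTheory.EllipticCurves.Rank1Residual.Typed
  Literature.NumberTheory.EllipticCurves.Kobayashi2003 Literature.NumberTheory.EllipticCurves.IwasawaDual
  ZpExtension Summit.BirchSwinnertonDyer.Rank1Residual Summit.BirchSwinnertonDyer.Rank1Residual.Supersingular

namespace Summit.BirchSwinnertonDyer.BirchSwinnertonDyer.Theorems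

namespace SSColemanRoad

/-! ## §1 The Coleman skeleton at any prime `p` and sign `ε` (Kobayashi §7 as module theory) -/

section AnyPrime

variable {p : ℕ} [Fact p.Prime] {W : WeierstrassCurve ℚ} [W.IsElliptic]
  [ContinuousSMul ℤ_[p] (W.tateModule p)]
  {κ : ZpExtension ℚ p} {γ : Field.absoluteGaloisGroup ℚ} {ε : ℤˣ}
  {P : Type*} [AddCommGroup P] [Module (IwasawaAlgebra p) P]

/-- **Kobayashi Thm. 7.3 ii) / the torsion clause of Thm. 1.2, FROM the Coleman skeleton (any `p`, any
sign).** On the pinned `𝐇¹ = I.H` (torsion free of rank `≤ 1`: Kato Thm. 12.4 (2)), `X⁰ = Y.X` (torsion: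
Cor. 7.2) and `X^ε = D.X`: if `𝐇¹ →loc P →toX X^ε →δ X⁰` is exact at `P` and at `X^ε` ((7.21)),
`col : P ↪ Λ` is injective (Thm. 6.2) and some `G ≠ 0` lies in `col(loc Z)` (Thm. 6.3 + Rohrlich), then
`X^ε(E/ℚ_∞)` is `Λ`-torsion. Pure module theory (`Kato2004.thm17_4_skeleton`).
[cite: Kobayashi2003, Thm. 7.3 (p. 13)] [cite: Kato2004Asterisque, Thm. 17.4 (1) and §17.13 (p. 280)] -/
theorem signedSelmerDual_isTorsion_of_colemanSkeleton
    (I : Kato2004.IwasawaH1Data W p κ γ) [Module.IsTorsionFree (IwasawaAlgebra p) I.H]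
    (hrank : Module.rank (IwasawaAlgebra p) I.H ≤ 1)
    (Y : W.FineSelmerDualData κ γ) (D : SignedSelmerDualData W κ γ ε)
    (loc : I.H →ₗ[IwasawaAlgebra p] P) (col : P →ₗ[IwasawaAlgebra p] IwasawaAlgebra p)
    (hcol : Function.Injective col)
    (toX : P →ₗ[IwasawaAlgebra p] D.X) (δ : D.X →ₗ[IwasawaAlgebra p] Y.X)
    (hPX : Function.Exact loc toX) (hXY : Function.Exact toX δ)
    (hY : Module.IsTorsion (IwasawaAlgebra p) Y.X)
    (Z : Submodule (IwasawaAlgebra p) I.H) {G : IwasawaAlgebra p} (hG : G ≠ 0)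
    (hGZ : G ∈ Submodule.map (col ∘ₗ loc) Z) :
    Module.IsTorsion (IwasawaAlgebra p) D.X :=
  (Kato2004.thm17_4_skeleton hrank loc toX δ hPX hXY col hcol hY Z hG hGZ).1

/-- **Kobayashi Thm. 4.1 with `n = 0`, FROM the Coleman skeleton (any `p`, any sign).** In the situation
of `signedSelmerDual_isTorsion_of_colemanSkeleton`, if moreover the Euler-system bound
`length_𝔭 X⁰ ≤ length_𝔭 (𝐇¹/Z)` holds at EVERY height-one prime `𝔭` (Kato Thm. 12.5 (4) = Kobayashi
Thm. 5.2 v), through Prop. 7.1 ii) `𝐇² ≅ X⁰`), then for a characteristic power series `g` of `X^ε`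
(`char X^ε = (g)`; `Λ` is a UFD) one has `g · h = G` for some `h ∈ Λ` — i.e. `G ∈ char X^ε`. For
`G = 0` the conclusion is trivial (`h = 0`); otherwise it is `Kato2004.mem_charIdeal_of_skeleton_integral`
(finite generation of `X^ε` being the tree theorem `SignedSelmerDualData.moduleFinite`).
[cite: Kobayashi2003, Thm. 4.1 (p. 8) and p. 13 (last sentence of §7)]
[cite: Kato2004Asterisque, Thm. 12.5 (4) (p. 222) and Thm. 17.4 (3) (p. 273)] -/
theorem exists_charGenerator_mul_eq_of_colemanSkeleton (hγ : κ.IsTopGenerator γ)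
    (I : Kato2004.IwasawaH1Data W p κ γ) [Module.IsTorsionFree (IwasawaAlgebra p) I.H]
    (hrank : Module.rank (IwasawaAlgebra p) I.H ≤ 1)
    (Y : W.FineSelmerDualData κ γ) (D : SignedSelmerDualData W κ γ ε)
    (loc : I.H →ₗ[IwasawaAlgebra p] P) (col : P →ₗ[IwasawaAlgebra p] IwasawaAlgebra p)
    (hcol : Function.Injective col)
    (toX : P →ₗ[IwasawaAlgebra p] D.X) (δ : D.X →ₗ[IwasawaAlgebra p] Y.X)
    (hPX : Function.Exact loc toX) (hXY : Function.Exact toX δ)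
    (hY : Module.IsTorsion (IwasawaAlgebra p) Y.X)
    (Z : Submodule (IwasawaAlgebra p) I.H) {G : IwasawaAlgebra p}
    (hGZ : G ∈ Submodule.map (col ∘ₗ loc) Z)
    (hES : ∀ 𝔭 : PrimeSpectrum (IwasawaAlgebra p), 𝔭.asIdeal.height = 1 →
      Literature.NumberTheory.EllipticCurves.Module.lengthAt (IwasawaAlgebra p) Y.X 𝔭 ≤
        Literature.NumberTheory.EllipticCurves.Module.lengthAt (IwasawaAlgebra p) (I.H ⧸ Z) 𝔭) :
    ∃ g h : IwasawaAlgebra p, D.charIdeal = Ideal.span {g} ∧ g * h = G := by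
  obtain ⟨g, hg⟩ := (charIdeal_isPrincipal_holds p D.X).principal
  have hg' : D.charIdeal = Ideal.span {g} := hg
  by_cases hG : G = 0
  · exact ⟨g, 0, hg', by rw [mul_zero, hG]⟩
  · haveI : Module.Finite (IwasawaAlgebra p) D.X := D.moduleFinite hγ
    obtain ⟨-, hmem⟩ := Kato2004.mem_charIdeal_of_skeleton_integral p hrank loc toX δ hPX hXY col
      hcol hY Z hG hGZ hES
    have hmem' : G ∈ Ideal.span {g} := by rw [← hg']; exact hmem
    obtain ⟨h, hh⟩ := Ideal.mem_span_singleton'.mp hmem'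
    exact ⟨g, h, hg', by rw [mul_comm]; exact hh⟩

/-- **Kobayashi Thm. 4.1, first display (`pⁿ L ∈ Char X^ε`), FROM the RATIONAL Coleman skeleton (any
`p`, any sign; NO image hypothesis).** As above, but with the Euler-system bound only at the height-one
primes `𝔭 ∌ p` (Kato Thm. 12.5 (3), `f` good at `p` so `𝐇²_loc,𝔭 = 0` there): `X^ε` is torsion and
`p^m · G ∈ char X^ε` for some `m`. [cite: Kobayashi2003, Thm. 4.1 first display (p. 8)]
[cite: Kato2004Asterisque, Thm. 12.5 (3) (p. 222) and Thm. 17.4 (2) (p. 273)] -/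
theorem exists_pow_mul_mem_charIdeal_of_colemanSkeletonRat (hγ : κ.IsTopGenerator γ)
    (I : Kato2004.IwasawaH1Data W p κ γ) [Module.IsTorsionFree (IwasawaAlgebra p) I.H]
    (hrank : Module.rank (IwasawaAlgebra p) I.H ≤ 1)
    (Y : W.FineSelmerDualData κ γ) (D : SignedSelmerDualData W κ γ ε)
    (loc : I.H →ₗ[IwasawaAlgebra p] P) (col : P →ₗ[IwasawaAlgebra p] IwasawaAlgebra p)
    (hcol : Function.Injective col)
    (toX : P →ₗ[IwasawaAlgebra p] D.X) (δ : D.X →ₗ[IwasawaAlgebra p] Y.X)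
    (hPX : Function.Exact loc toX) (hXY : Function.Exact toX δ)
    (hY : Module.IsTorsion (IwasawaAlgebra p) Y.X)
    (Z : Submodule (IwasawaAlgebra p) I.H) {G : IwasawaAlgebra p} (hG : G ≠ 0)
    (hGZ : G ∈ Submodule.map (col ∘ₗ loc) Z)
    (hES : ∀ 𝔭 : PrimeSpectrum (IwasawaAlgebra p), 𝔭.asIdeal.height = 1 →
      PowerSeries.C (p : ℤ_[p]) ∉ 𝔭.asIdeal →
      Literature.NumberTheory.EllipticCurves.Module.lengthAt (IwasawaAlgebra p) Y.X 𝔭 ≤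
        Literature.NumberTheory.EllipticCurves.Module.lengthAt (IwasawaAlgebra p) (I.H ⧸ Z) 𝔭) :
    Module.IsTorsion (IwasawaAlgebra p) D.X ∧
      ∃ m : ℕ, PowerSeries.C (p : ℤ_[p]) ^ m * G ∈ D.charIdeal := by
  haveI : Module.Finite (IwasawaAlgebra p) D.X := D.moduleFinite hγ
  obtain ⟨htors, hlen⟩ := Kato2004.thm17_4_skeleton hrank loc toX δ hPX hXY col hcol hY Z hG hGZ
  exact ⟨htors, Literature.NumberTheory.EllipticCurves.Module.exists_pow_mul_mem_charIdeal_of_lengthAt_le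
    htors (IwasawaAlgebra.prime_C p) hG fun 𝔭 h1 hp𝔭 ↦ hlen 𝔭 (hES 𝔭 h1 hp𝔭)⟩

/-- **Where the image hypothesis bites: the `μ`-part only.** In the UFD `Λ`, if `g ∣ π^m · G` for a
prime `π` not dividing `g`, then `g ∣ G`. Applied with `π = p` (`IwasawaAlgebra.prime_C`): the rational
divisibility (no image hypothesis) plus `μ(g) = 0` give the integral one. [folklore: UFD cancellation]
[cite: Kobayashi2003, Thm. 4.1 (p. 8), the passage from `pⁿ` to `n = 0`] -/
theorem dvd_of_dvd_C_pow_mul_of_not_dvd {π g G : IwasawaAlgebra p} (hπ : Prime π) (hπg : ¬ π ∣ g) :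
    ∀ {m : ℕ}, g ∣ π ^ m * G → g ∣ G
  | 0, h => by simpa using h
  | m + 1, h => by
    obtain ⟨k, hk⟩ := h
    -- `π ∣ g * k`, `π ∤ g` ⇒ `π ∣ k`
    have hπk : π ∣ g * k := ⟨π ^ m * G, by rw [← hk, pow_succ]; ring⟩
    rcases hπ.dvd_or_dvd hπk with hbad | ⟨k', rfl⟩
    · exact absurd hbad hπg
    · refine dvd_of_dvd_C_pow_mul_of_not_dvd hπ hπg (m := m) ⟨k', ?_⟩
      have hπ0 : π ≠ 0 := hπ.ne_zero
      have h' : π * (π ^ m * G) = π * (g * k') := by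
        rw [← mul_assoc, ← pow_succ', hk]; ring
      exact mul_left_cancel₀ hπ0 h'

end AnyPrime

/-! ## §2 `p = 2`, sign `+`: the binder `hup` of p420436 / p450683 at the curve -/

section AtTwo

variable {W : WeierstrassCurve ℚ} [W.IsElliptic] [ContinuousSMul ℤ_[2] (W.tateModule 2)]
  {κ : ZpExtension ℚ 2} {γ : Field.absoluteGaloisGroup ℚ}
  {P : Type*} [AddCommGroup P] [Module (IwasawaAlgebra 2) P]

/-- **Stub (4) at the datum, from the Coleman skeleton at `2`.** `p = 2`, sign `+`: with `G` pinned by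
Kobayashi's Thm. 6.3 in the Néron normalisation, `ι G = ϖ · ι L♭` (`L♭ = kobayashiL 1 L⁺ L⁻`), the
conclusion of `exists_charGenerator_mul_eq_of_colemanSkeleton` is VERBATIM the body of the line's
`stub_zeroSignedUpper` at `(κ, γ, f, ϖ, L⁺, L⁻, D)`: `char X⁺ = (g)` and `ι(g·h) = ϖ·ι L♭`.
[cite: Kobayashi2003, Thm. 4.1 (p. 8) and Thm. 6.3 (p. 11)] -/
theorem signedUpperShape_two_of_colemanSkeleton (hγ : κ.IsTopGenerator γ)
    (I : Kato2004.IwasawaH1Data W 2 κ γ) [Module.IsTorsionFree (IwasawaAlgebra 2) I.H]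
    (hrank : Module.rank (IwasawaAlgebra 2) I.H ≤ 1)
    (Y : W.FineSelmerDualData κ γ) (D : SignedSelmerDualData W κ γ 1)
    (loc : I.H →ₗ[IwasawaAlgebra 2] P) (col : P →ₗ[IwasawaAlgebra 2] IwasawaAlgebra 2)
    (hcol : Function.Injective col)
    (toX : P →ₗ[IwasawaAlgebra 2] D.X) (δ : D.X →ₗ[IwasawaAlgebra 2] Y.X)
    (hPX : Function.Exact loc toX) (hXY : Function.Exact toX δ)
    (hY : Module.IsTorsion (IwasawaAlgebra 2) Y.X)
    (Z : Submodule (IwasawaAlgebra 2) I.H) {G : IwasawaAlgebra 2}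
    (hGZ : G ∈ Submodule.map (col ∘ₗ loc) Z)
    (hES : ∀ 𝔭 : PrimeSpectrum (IwasawaAlgebra 2), 𝔭.asIdeal.height = 1 →
      Literature.NumberTheory.EllipticCurves.Module.lengthAt (IwasawaAlgebra 2) Y.X 𝔭 ≤
        Literature.NumberTheory.EllipticCurves.Module.lengthAt (IwasawaAlgebra 2) (I.H ⧸ Z) 𝔭)
    {ϖ : ℚ} {Lplus Lminus : IwasawaAlgebra 2}
    (hιG : iwasawaToPowerSeries 2 G =
      PowerSeries.C (ϖ : ℚ_[2]) * iwasawaToPowerSeries 2 (kobayashiL 1 Lplus Lminus)) :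
    ∃ g h : IwasawaAlgebra 2, D.charIdeal = Ideal.span {g} ∧
      iwasawaToPowerSeries 2 (g * h) =
        PowerSeries.C (ϖ : ℚ_[2]) * iwasawaToPowerSeries 2 (kobayashiL 1 Lplus Lminus) := by
  obtain ⟨g, h, hg, hgh⟩ := exists_charGenerator_mul_eq_of_colemanSkeleton hγ I hrank Y D loc col
    hcol toX δ hPX hXY hY Z hGZ hES
  exact ⟨g, h, hg, by rw [hgh]; exact hιG⟩

omit [ContinuousSMul ℤ_[2] (W.tateModule 2)] in
/-- **The binder `hup` of p420436 / p450683 (= stub (4) AT THE CURVE `W`) from `Kato2004.thm12_4` and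
the Coleman–Kato package at `W`.** For every cyclotomic datum `(κ, γ)` matching the cyclotomic
variable, newform `f`, period ratio `ϖ`, Pollack pair `(L⁺, L⁻)` at `2` and dual datum `D` of
`Sel⁺(E/ℚ_∞)`, the package (module docstring, field by field) — `I, Y`, the image `P ≤ Λ` of `Col⁺`,
`loc, toX, δ` with (7.21)@2, `X⁰` torsion@2, `G ∈ loc(Z)` with `ι G = ϖ·ι L♭` (Thm. 6.3@2), and the
Euler-system bound@2 at every height-one prime — yields `char X⁺ = (g)`, `ι(g·h) = ϖ·ι L♭`. The
continuity binder of `IwasawaH1Data` is DISCHARGED (`TateModule.continuousSMul_padicInt`); `𝐇¹_Γ(T₂W)`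
is torsion free of rank `1` by `Kato2004.thm12_4` (PRINT, any `p`).
[cite: Kobayashi2003, Thm. 4.1 (p. 8), Thm. 6.2–6.3 (p. 11), Cor. 7.2 and Thm. 7.3 (p. 13)]
[cite: Kato2004Asterisque, Thm. 12.4 (2) (p. 221) and Thm. 12.5 (4) (p. 222)] -/
theorem signedUpperDivisibility_two_of_colemanKato (h124 : Kato2004.thm12_4)
    (hCK : ∀ (κ : ZpExtension ℚ 2) (γ : Field.absoluteGaloisGroup ℚ),
      κ.IsCyclotomic → κ.IsTopGenerator γ → IsCyclotomicVariable 2 γ →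
      ∀ [NeZero (W.conductorNorm ℤ)] (f : CuspForm (Gamma0 (W.conductorNorm ℤ)) 2),
        IsNewformOf W f → ∀ (ϖ : ℚ), (ϖ : ℝ) * W.realPeriodRat = plusPeriod f →
      ∀ (Lplus Lminus : IwasawaAlgebra 2), IsPollackPair f 2 Lplus Lminus →
      ∀ (D : SignedSelmerDualData W κ γ 1) [ContinuousSMul ℤ_[2] (W.tateModule 2)],
        ∃ (I : Kato2004.IwasawaH1Data W 2 κ γ) (Y : W.FineSelmerDualData κ γ)
          (P : Submodule (IwasawaAlgebra 2) (IwasawaAlgebra 2))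
          (loc : I.H →ₗ[IwasawaAlgebra 2] P) (toX : P →ₗ[IwasawaAlgebra 2] D.X)
          (δ : D.X →ₗ[IwasawaAlgebra 2] Y.X) (Z : Submodule (IwasawaAlgebra 2) I.H)
          (G : IwasawaAlgebra 2),
          Function.Exact loc toX ∧ Function.Exact toX δ ∧
          Module.IsTorsion (IwasawaAlgebra 2) Y.X ∧
          G ∈ Submodule.map (P.subtype ∘ₗ loc) Z ∧
          iwasawaToPowerSeries 2 G =
            PowerSeries.C (ϖ : ℚ_[2]) * iwasawaToPowerSeries 2 (kobayashiL 1 Lplus Lminus) ∧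
          ∀ 𝔭 : PrimeSpectrum (IwasawaAlgebra 2), 𝔭.asIdeal.height = 1 →
            Literature.NumberTheory.EllipticCurves.Module.lengthAt (IwasawaAlgebra 2) Y.X 𝔭 ≤
              Literature.NumberTheory.EllipticCurves.Module.lengthAt (IwasawaAlgebra 2) (I.H ⧸ Z) 𝔭) :
    ∀ (κ : ZpExtension ℚ 2) (γ : Field.absoluteGaloisGroup ℚ),
      κ.IsCyclotomic → κ.IsTopGenerator γ → IsCyclotomicVariable 2 γ →
      ∀ [NeZero (W.conductorNorm ℤ)] (f : CuspForm (Gamma0 (W.conductorNorm ℤ)) 2),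
        IsNewformOf W f → ∀ (ϖ : ℚ), (ϖ : ℝ) * W.realPeriodRat = plusPeriod f →
      ∀ (Lplus Lminus : IwasawaAlgebra 2), IsPollackPair f 2 Lplus Lminus →
      ∀ (D : SignedSelmerDualData W κ γ 1),
        ∃ g h : IwasawaAlgebra 2, D.charIdeal = Ideal.span {g} ∧
          iwasawaToPowerSeries 2 (g * h) =
            PowerSeries.C (ϖ : ℚ_[2]) * iwasawaToPowerSeries 2 (kobayashiL 1 Lplus Lminus) := by
  intro κ γ hκ hγ hγ' _ f hf ϖ hϖ Lplus Lminus hPP D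
  haveI : ContinuousSMul ℤ_[2] (W.tateModule 2) := TateModule.continuousSMul_padicInt
  obtain ⟨I, Y, P, loc, toX, δ, Z, G, hPX, hXY, hY, hGZ, hιG, hES⟩ :=
    hCK κ γ hκ hγ hγ' f hf ϖ hϖ Lplus Lminus hPP D
  obtain ⟨htf, hrank⟩ := h124.isTorsionFree_and_rank_le_one W 2 hκ hγ I
  haveI := htf
  exact signedUpperShape_two_of_colemanSkeleton hγ I hrank Y D loc P.subtype P.injective_subtype toX δ
    hPX hXY hY Z hGZ hES hιG

/-- **The RATIONAL road plus `μ(X⁺) = 0` (NO image hypothesis).** From the rational package at the datum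
(Euler-system bound only at the height-one `𝔭 ∌ 2`: Kato Thm. 12.5 (3), printed with no image
hypothesis and no parity of `p`) one gets Kobayashi's first display `2^m·G ∈ char X⁺` (`G ≠ 0` pinned
to `ϖ·L♭`); if the characteristic power series `g` of `X⁺` is NOT divisible by `2` (`μ(X⁺) = 0`), then
already `g·h = G`, hence stub (4) at the datum. So the `2`-adic image hypothesis (12.5.2) enters stub
(4) EXACTLY through the `μ`-part of `X⁺(E/ℚ_∞)`. [cite: Kobayashi2003, Thm. 4.1 (p. 8)]
[cite: Kato2004Asterisque, Thm. 12.5 (3)–(4) (p. 222)] -/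
theorem signedUpperDivisibility_two_of_colemanKatoRat_of_mu (hγ : κ.IsTopGenerator γ)
    (I : Kato2004.IwasawaH1Data W 2 κ γ) [Module.IsTorsionFree (IwasawaAlgebra 2) I.H]
    (hrank : Module.rank (IwasawaAlgebra 2) I.H ≤ 1)
    (Y : W.FineSelmerDualData κ γ) (D : SignedSelmerDualData W κ γ 1)
    (loc : I.H →ₗ[IwasawaAlgebra 2] P) (col : P →ₗ[IwasawaAlgebra 2] IwasawaAlgebra 2)
    (hcol : Function.Injective col)
    (toX : P →ₗ[IwasawaAlgebra 2] D.X) (δ : D.X →ₗ[IwasawaAlgebra 2] Y.X)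
    (hPX : Function.Exact loc toX) (hXY : Function.Exact toX δ)
    (hY : Module.IsTorsion (IwasawaAlgebra 2) Y.X)
    (Z : Submodule (IwasawaAlgebra 2) I.H) {G : IwasawaAlgebra 2} (hG : G ≠ 0)
    (hGZ : G ∈ Submodule.map (col ∘ₗ loc) Z)
    (hES : ∀ 𝔭 : PrimeSpectrum (IwasawaAlgebra 2), 𝔭.asIdeal.height = 1 →
      PowerSeries.C (2 : ℤ_[2]) ∉ 𝔭.asIdeal →
      Literature.NumberTheory.EllipticCurves.Module.lengthAt (IwasawaAlgebra 2) Y.X 𝔭 ≤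
        Literature.NumberTheory.EllipticCurves.Module.lengthAt (IwasawaAlgebra 2) (I.H ⧸ Z) 𝔭)
    {g : IwasawaAlgebra 2} (hg : D.charIdeal = Ideal.span {g})
    (hμ : ¬ PowerSeries.C (2 : ℤ_[2]) ∣ g)
    {ϖ : ℚ} {Lplus Lminus : IwasawaAlgebra 2}
    (hιG : iwasawaToPowerSeries 2 G =
      PowerSeries.C (ϖ : ℚ_[2]) * iwasawaToPowerSeries 2 (kobayashiL 1 Lplus Lminus)) :
    ∃ h : IwasawaAlgebra 2,
      iwasawaToPowerSeries 2 (g * h) =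
        PowerSeries.C (ϖ : ℚ_[2]) * iwasawaToPowerSeries 2 (kobayashiL 1 Lplus Lminus) := by
  obtain ⟨-, m, hm⟩ := exists_pow_mul_mem_charIdeal_of_colemanSkeletonRat hγ I hrank Y D loc col
    hcol toX δ hPX hXY hY Z hG hGZ (fun 𝔭 h1 hp𝔭 ↦ hES 𝔭 h1 (by simpa using hp𝔭))
  have h2C : (PowerSeries.C ((2 : ℕ) : ℤ_[2]) : IwasawaAlgebra 2) = PowerSeries.C (2 : ℤ_[2]) := by
    simp
  rw [h2C, hg] at hm
  have hdvd : g ∣ PowerSeries.C (2 : ℤ_[2]) ^ m * G := Ideal.mem_span_singleton.mp hm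
  have h2 : Prime (PowerSeries.C (2 : ℤ_[2]) : IwasawaAlgebra 2) := by
    rw [← h2C]; exact IwasawaAlgebra.prime_C 2
  obtain ⟨h, hh⟩ := dvd_of_dvd_C_pow_mul_of_not_dvd h2 hμ hdvd
  exact ⟨h, by rw [← hh]; exact hιG⟩

end AtTwo

end SSColemanRoad

end Summit.BirchSwinnertonDyer.BirchSwinnertonDyer.Theorems

end
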